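import Summits.Ventures.CertifiedManyBodySolver.Rows.CorrWindowCertKernelChainForest
import Summits.Ventures.CertifiedManyBodySolver.Rows.CorrWindowCertKernelLowerConstChunks
import HarnessLib

/-!
# STEP-0 of the CHAIN FOREST: the half-row bond toy (p684830) replayed as TWO segments from the empty accumulator (steps 0–1 ∣ step 2)
# + ONE merge, closed by `affineOrbitLowerRowN_of_forestTBRowsHalfAuto_box 0 1 1` — ZERO hypotheses, same `−1` bound

HONEST FRAMING: a TOY; the forest twin of `Certificates/HubbardSquare_tpm3o10_U29o5_toyKernelCert_bondRowHalf.lean`: same data (two-row block by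
half rows, kernel eom masks, one translation hint), geometry `boxQuot 0 1 1` (S = univ), the three steps cut into the forest `[⟨2, Cs₁⟩, ⟨1, Cs₂⟩]`
with both segments starting from `[]`, the merged end `Cfin := eval% mergeAllE 32 (ends segs)` re-derived by the kernel, the inequality on `Cfin`, and
the box forest closer — i.e. the exact shape of a `--forest P` instance's ForestAssembly + Closer. Trust base: the Lean kernel (std axioms). No number
of record; no existing claim node discharged; CONTROL/CALIBRATION context (wording (xx1)); silent on ρ_s = 0 / presence / T_c / phase; nothing about
La₂CuO₄; no summit statement is proved by this file. Seat hubbard-obs-p2 (STIFFNESS), `prover-hubbard-obs-p2-g24-0`, zero compute.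

References: X. Han, arXiv:2006.06002 §3 [Han2020Bootstrap]; J. Wang et al., PRX 14 (2024) 031006 §III [WangEtAl2024];
C. Jansson, D. Chaykin, C. Keil, SIAM J. Numer. Anal. 46 (2008) 180 [JanssonChaykinKeil2008].
-/

namespace Summit.Ventures.CertifiedManyBodySolver

namespace CARPolyWindow

namespace ToyForest1

open Summit.Ventures.CertifiedQuantumChemistry Summit.Ventures.CertifiedQuantumChemistry.CARPoly
open Literature.MathematicalPhysics.QuantumLattice Literature.MathematicalPhysics.QuantumLattice.HubbardWave0
open Matrix BoxGeom

/-! ## Data (outer box `R = 1`: 9 sites, index 4 = origin, 7 = e₁; inner box `r = 0`) -/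

/-- The objective: the `↓`-spin bond word through the origin and `e₁`. [folklore] -/
def TXf : Terms (Orb (Fin 9)) := [([(orb 4 1, true), (orb 7 1, false)], 1), ([(orb 7 1, true), (orb 4 1, false)], 1)]

/-- Density multipliers `μ_↑ = 0`, `μ_↓ = −2`. [folklore] -/
def muf (σ : Fin 2) : ℚ := if σ = 1 then -2 else 0

/-- The two-row block (rows `[1]`, words `a_{0↓}`, `a_{e₁↓}`, `K = 0`). [cite: Han2020Bootstrap, §2 eq. (2)] -/
def blocksf : List (List (List ℤ × Terms (Orb (Fin 9)))) := [[([1], [([(orb 4 1, false)], 1)]), ([1], [([(orb 7 1, false)], 1)])]]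

/-- The geometry: `boxQuot 0 1 1` (all eight `D₄` codes licensed, shifts ≤ 1). [folklore] -/
def Df : QuotData 9 1 := boxQuot 0 1 1

/-- Window Hamiltonian, energy dictionary, origin letters — the box forms. [folklore] -/
def THf : Terms (Orb (Fin 9)) := hamTermsBox 1 1 (-3 / 10) (29 / 5)
/-- The mean-energy dictionary, box form. [folklore] -/
def TEf : Terms (Orb (Fin 9)) := energyTermsIdx 1 (-3 / 10) (29 / 5) (boxIx 1)
/-- The origin letters, box form. [folklore] -/
def of : Fin 2 → Orb (Fin 9) := fun σ => orb (boxIx 1 0) σ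

/-- The slices: head · half-row 1 · REST (half-row 2 ++ CW ++ AV). [cite: WangEtAl2024, §III] -/
def slicesf : List (Terms (Orb (Fin 9))) :=
  groupSlices (residTGslicesNear TXf muf 0 of 0 0 0 0 TEf (gramTBRowsHalf 0 blocksf) THf Df.f [] (autoMasks THf Df.f [])
    (fun l : Fin 0 => l.elim0) (fun l : Fin 0 => l.elim0) [] []) [1, 1]

/-- Global hint lists (one translation hint on the last slice). [cite: Han2020Bootstrap, §3] -/
def Hsf : List (List (QHint 1)) := [[], [], [⟨0, (1, 0), ([orb 0 1], [orb 0 1])⟩]]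

/-! ## Segment 1 = steps 0, 1 from `[]`; segment 2 = step 2 from `[]` -/

/-- Segment 1, accumulator 0: EMPTY. [folklore] -/
def C10 : SOSDual.EncPoly := []
/-- Segment 1, accumulator 1 (`eval%`). [folklore] -/
def C11 : SOSDual.EncPoly := eval% stepEQA Df 32 C10 (slicesf.getD 0 []) (Hsf.getD 0 [])
/-- Segment 1, accumulator 2 = its end. [folklore] -/
def C12 : SOSDual.EncPoly := eval% stepEQA Df 32 C11 (slicesf.getD 1 []) (Hsf.getD 1 [])
/-- Segment 2, accumulator 0: EMPTY (the forest's point: NOT segment 1's end). [folklore] -/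
def C20 : SOSDual.EncPoly := []
/-- Segment 2, accumulator 1 = its end. [folklore] -/
def C21 : SOSDual.EncPoly := eval% stepEQA Df 32 C20 (slicesf.getD 2 []) (Hsf.getD 2 [])

/-- KERNEL FACT, segment 1 step 0 (global 0). -/
theorem step_0 : C11 = stepEQA Df 32 C10 (slicesf.getD 0 []) (Hsf.getD 0 []) := eq_of_beq (by decide +kernel)
/-- KERNEL FACT, segment 1 step 1 (global 1). -/
theorem step_1 : C12 = stepEQA Df 32 C11 (slicesf.getD 1 []) (Hsf.getD 1 []) := eq_of_beq (by decide +kernel)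
/-- KERNEL FACT, segment 2 step 0 (global 2), from the EMPTY accumulator. -/
theorem step_2 : C21 = stepEQA Df 32 C20 (slicesf.getD 2 []) (Hsf.getD 2 []) := eq_of_beq (by decide +kernel)

/-- Segment 1 accumulators. [folklore] -/
def Cs1 : List SOSDual.EncPoly := [C10, C11, C12]
/-- Segment 2 accumulators. [folklore] -/
def Cs2 : List SOSDual.EncPoly := [C20, C21]

/-- Segment 1's steps (offset 0). -/
theorem steps_1 : StepsOff Df 32 0 Cs1 slicesf Hsf 0 2 := StepsOff.cons step_0 (StepsOff.cons step_1 (StepsOff.nil 2))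
/-- Segment 2's step (offset 2). -/
theorem steps_2 : StepsOff Df 32 2 Cs2 slicesf Hsf 0 1 := StepsOff.cons step_2 (StepsOff.nil 1)

/-- The forest. -/
def segs : List Seg := [⟨2, Cs1⟩, ⟨1, Cs2⟩]

/-- The forest record: both segments from `[]`, consecutive, ending at `slicesf.length = 3`. -/
theorem forest_ok : ForestFrom Df 32 slicesf Hsf 0 segs :=
  forestFrom_cons rfl steps_1 (forestFrom_cons rfl steps_2 (forestFrom_nil (by decide +kernel)))

/-- The ONE merge of the two ends. -/
def Cfin : SOSDual.EncPoly := eval% mergeAllE 32 (ends segs)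
/-- KERNEL FACT: the merge. -/
theorem fin_ok : Cfin = mergeAllE 32 (ends segs) := eq_of_beq (by decide +kernel)

/-- The ONE inequality on the merged end (read at `n₀ = 1`). -/
theorem forest_lowerConst : (-1 : ℚ) ≤ lowerConst (SOSDual.decPoly 9 Cfin) + (muf 0 + muf 1) * ((1 : ℚ) / 2 - 0) := by
  decide +kernel

/-- **STEP-0 of the chain forest: the affine-N row of the bond toy from TWO segments + one merge — ZERO hypotheses.** [cite: WangEtAl2024, §III] -/
theorem forest_affineOrbitLowerRowN :
    SquareTTPrimeCorrAffineOrbitLowerRowN (((-3 / 10 : ℚ)) : ℝ) (((29 / 5 : ℚ)) : ℝ) (-1) 0 0 0 0 (-1) 1 Finset.univ (boxW 1)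
      (termOp (boxD 1) TXf) :=
  affineOrbitLowerRowN_of_forestTBRowsHalfAuto_box 0 1 1 (by norm_num) (by norm_num) (-3 / 10) (29 / 5) (by norm_num) 32 Df rfl THf rfl
    TEf rfl of rfl TXf muf 0 0 0 0 0 0 blocksf [] [] (fun wc hwc => absurd hwc List.not_mem_nil) [] [1, 1] Hsf segs forest_ok Cfin fin_ok
    (by norm_num [muf]) forest_lowerConst

end ToyForest1

end CARPolyWindow

end Summit.Ventures.CertifiedManyBodySolver
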